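import Summits.AtomisticToContinuum.Crystallization.Theorems.FrustratedLawDichotomyStrainedPatchHomCurvLJLeaf
import Summits.AtomisticToContinuum.Crystallization.Theorems.FrustratedLawDichotomyStrainedPatchHomSlopeLeafC
import Summits.AtomisticToContinuum.Crystallization.Theorems.FrustratedLawDichotomyStrainedPatchHomForceRing

/-!
# The CENTRED SLOPE LEAF of the PURE Lennard-Jones profile: the reference force bound `f₀` of the ring lemma from ONE Boolean

decomp-a2c hand-1 g28 (crux `AperiodicFrustratedLawGap`, stmt-AtomisticToContinuum-27623; `(H) HomFloor (1/625)`, hcp half; critic rows 1089/1102 (T″ ring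
leaf inputs: `λ` = `…HomCurvLJLeaf.curvCheckLJ`, `f₀` = THIS file, `σ` = the exemption cap)).  Verbatim the centred slope leaf `…HomSlopeLeafC.slopeCheckC`
with the W₄₅ coefficients replaced by the pure LJ closed forms (no regimes, no junctions):

* §1 ★ `label_slope_LJ` — per-label centred estimate `|βᴸᴶ(‖c_b‖)⟪c_b,Δ⟫ − β₀⟪p_b,Δ⟫ − (α₀⟪p_b,d_b⟫⟪p_b,Δ⟫ + β₀⟪d_b,Δ⟫)| ≤ (KSl/SC)/2·(nd2S2/SC)·‖Δ‖`
  on ANY positive tube (`…HomSlopePath.slopeForm_secondOrder` with `B = betaLJ`, `B₁ = alphaLJ·r`, `B₂ = alpha1LJ·r + alphaLJ`; `…HomSlopeCentre.kSlopeS`);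
* §2 kernel `slopeLJLabelOK`, `KSlLJ`, arrays `H0LJ/MarrLJ/NarrLJ/VvecLJ/linLJ/G0LJ/g0LJ/remSlLJ/GnLJ/naiSLJ`, ★ `slopeCheckLJ c w Lc Ln Gs`, `slopeGsLJ`;
* §3 ★★★ `slopeLJ_bound_of_check`: `|Σ_{b∈(Lc++Ln).toFinset} segG (fun x => x⁻¹^7 − x⁻¹^13) (latPt U hexFrame b + U(hcpShift+ξ₀)) (U(ξ−ξ₀)) 0| ≤ (Gs/SC)‖U(ξ−ξ₀)‖`
  and ★★★ `forceLJ_ref_bound_of_check` — the same in the KERNEL FORM `|Σ_b (‖X_b‖⁻⁸ − ‖X_b‖⁻¹⁴)⟪X_b, U(ξ−ξ₀)⟫| ≤ (Gs/SC)‖U(ξ−ξ₀)‖`, `X_b = latPt U hexFrame b +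
  U(hcpShift+ξ₀)` — EXACTLY the `hf₀` input of `…HomForceRing.hcpForceLJ_slab_confinement` / `…HomCurvLJRing.hcpForceLJ_slab_of_checkLJ`.

Kernel definitions + soundness; 0 sorry; standard axioms; no instances / notation / `#eval`.  `--supports stmt-AtomisticToContinuum-27623`.
-/

noncomputable section

namespace Summit.AtomisticToContinuum.Crystallization.Theorems.FrustratedLawDichotomyStrainedPatchHomSlopeLJ

open scoped BigOperators RealInnerProductSpace
open Literature.Analysis.ValidatedNumerics.Numerics
open Summit.AtomisticToContinuum.Crystallization.Theorems.ChargedEnergyGapNegative (E3)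
open Summit.AtomisticToContinuum.Crystallization.Theorems.FrustratedLawDichotomyStrainedPatchHomSplit (latPt hexFrame hcpShift)
open Summit.AtomisticToContinuum.Crystallization.Theorems.FrustratedLawDichotomyStrainedPatchHomEntryGram (entryFI mem_entryFI)
open Summit.AtomisticToContinuum.Crystallization.Theorems.FrustratedLawDichotomyStrainedPatchHomEntryGramHcp (dot3 shufFI mem_dot3 mem_shufFI)
open Summit.AtomisticToContinuum.Crystallization.Theorems.FrustratedLawDichotomyStrainedPatchHomForceKit (vecB mem_vecB phiFI mem_phiFI)
open Summit.AtomisticToContinuum.Crystallization.Theorems.FrustratedLawDichotomyStrainedPatchHomCurvCoeff3 (ljTripleFI mem_ljTripleFI)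
open Summit.AtomisticToContinuum.Crystallization.Theorems.FrustratedLawDichotomyStrainedPatchHomCurvRegime3
open Summit.AtomisticToContinuum.Crystallization.Theorems.FrustratedLawDichotomyStrainedPatchHomCurvKit (accFI mem_accFI)
open Summit.AtomisticToContinuum.Crystallization.Theorems.FrustratedLawDichotomyStrainedPatchHomConvexCurvature (segG_zero_eq inner_eq_sum3)
open Summit.AtomisticToContinuum.Crystallization.Theorems.FrustratedLawDichotomyStrainedPatchHomCurvCentre (pert_rearrange pert_abs_le)
open Summit.AtomisticToContinuum.Crystallization.Theorems.FrustratedLawDichotomyStrainedPatchHomCurvCentreKit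
open Summit.AtomisticToContinuum.Crystallization.Theorems.FrustratedLawDichotomyStrainedPatchHomCurvLeafL (dflt3 rem_term_le)
open Summit.AtomisticToContinuum.Crystallization.Theorems.FrustratedLawDichotomyStrainedPatchHomSlopePath (slopeForm_secondOrder)
open Summit.AtomisticToContinuum.Crystallization.Theorems.FrustratedLawDichotomyStrainedPatchHomSlopeCentre (kSlopeS kSlope_of_mem)
open Summit.AtomisticToContinuum.Crystallization.Theorems.FrustratedLawDichotomyStrainedPatchHomSlopeLeafC (abs_sum_mul_le_sqrtHi H0r linSlope_eq)
open Summit.AtomisticToContinuum.Crystallization.Theorems.FrustratedLawDichotomyStrainedPatchHomCurvLJ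
  (betaLJ_eq_profile betaLJ_of_mem_phiFI Q0 ttLJ t0LJ A0lj B0lj naiveLJ mem_naiveLJ)
open Summit.AtomisticToContinuum.Crystallization.Theorems.FrustratedLawDichotomyStrainedPatchHomForceRing (segG_ljProfile_zero)
open Summit.AtomisticToContinuum.Crystallization.Theorems.FrustratedLawDichotomyStrainedPatchTaylorChord (segR segG)
open Summit.AtomisticToContinuum.Crystallization.Theorems.FrustratedLawDichotomyStrainedPatchHomLatticeBoxHcp (norm_shifted_gt)

/-! ## §1. The per-label centred slope estimate (pure LJ, any positive tube) -/

/-- ★ **PER-LABEL CENTRED SLOPE ESTIMATE, PURE LJ PROFILE.** [folklore chaining: `slopeForm_secondOrder` + `ljTripleFI`/`kSlope_of_mem`] -/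
theorem label_slope_LJ {c w : (Fin 3 × Fin 3) ⊕ Fin 3 → ℤ} {b : Fin 3 → ℤ} (hlo : 0 < (tube2 c w b).lo)
    {tt t0 : FI × FI × FI} {B0 : FI}
    (htt : ljTripleFI ((tube2 c w b).mul (tube2 c w b)) = some tt) (ht0 : ljTripleFI (dot3 (cenVec c b) (cenVec c b)) = some t0)
    (hb0 : phiFI (dot3 (cenVec c b) (cenVec c b)) = some B0) (U : E3 →L[ℝ] E3)
    (hbox : ∀ ab : Fin 3 × Fin 3, |(U (EuclideanSpace.single ab.2 (1 : ℝ))) ab.1 - (c (Sum.inl ab) : ℝ) / SC| ≤ (w (Sum.inl ab) : ℝ) / SC)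
    (η : E3) (hη : ∀ i : Fin 3, |η i - (c (Sum.inr i) : ℝ) / SC| ≤ (w (Sum.inr i) : ℝ) / SC) (Δ : E3) :
    FI.mem (alphaLJ ‖cenPt c b‖) t0.1 ∧ FI.mem (betaLJ ‖cenPt c b‖) B0 ∧
      |betaLJ ‖latPt U hexFrame b + U (hcpShift + η)‖ * ⟪latPt U hexFrame b + U (hcpShift + η), Δ⟫ - betaLJ ‖cenPt c b‖ * ⟪cenPt c b, Δ⟫ -
          (alphaLJ ‖cenPt c b‖ * ⟪cenPt c b, latPt U hexFrame b + U (hcpShift + η) - cenPt c b⟫ * ⟪cenPt c b, Δ⟫ +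
            betaLJ ‖cenPt c b‖ * ⟪latPt U hexFrame b + U (hcpShift + η) - cenPt c b, Δ⟫)| ≤
        ((kSlopeS tt (tube2 c w b) : ℤ) : ℝ) / SC / 2 * ((nd2S2 c w b : ℝ) / SC) * ‖Δ‖ := by
  have hS : (0 : ℝ) < SC := by norm_num [SC]
  set T := tube2 c w b with hT
  set p := cenPt c b with hp
  set cb := latPt U hexFrame b + U (hcpShift + η) with hcb
  set d := cb - p with hd
  set aa : ℝ := (T.lo : ℝ) / SC with haa
  set bb : ℝ := (T.hi : ℝ) / SC with hbb
  have ha : 0 < aa := div_pos (by exact_mod_cast hlo) hS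
  have hreg' : ∀ r, aa < r → r < bb → r ≠ 0 := fun r h1 _ => (ha.trans h1).ne'
  have htube : ∀ t ∈ Set.Icc (0 : ℝ) 1, aa < segR p d t ∧ segR p d t < bb := fun t ht => by
    have := tube2_mem U hbox η hη b ht
    simpa [segR, hp, hd, hcb] using this
  set K : ℝ := ((kSlopeS tt T : ℤ) : ℝ) / SC with hKdef
  have hSF := slopeForm_secondOrder (B := betaLJ) (B₁ := fun s => alphaLJ s * s) (B₂ := fun s => alpha1LJ s * s + alphaLJ s)
    (K := K) (p := p) (d := d) (Δ := Δ) ha htube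
    (fun r h1 h2 => hasDerivAt_betaLJ (hreg' r h1 h2))
    (fun r h1 h2 => hasDerivAt_alphaLJ_mul (hreg' r h1 h2))
    (fun r h1 h2 => by
      have hmT : FI.mem r T := mem_of_strict h1 h2
      have hq2 : FI.mem (r ^ 2) (T.mul T) := by rw [sq]; exact FI.mem_mul hmT hmT
      obtain ⟨m0, m1, _⟩ := mem_ljTripleFI hq2 htt
      have key := kSlope_of_mem (ha.trans h1) hmT.2 m0 m1
      simpa only using key)
  -- centre data
  have h0t := htube 0 (by simp)
  have hR0 : segR p d 0 = ‖p‖ := by simp [segR]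
  rw [hR0] at h0t
  have hρpos : 0 < ‖p‖ := ha.trans h0t.1
  have hρne : ‖p‖ ≠ 0 := hρpos.ne'
  have hQ0 := (mem_rho0 c b).1
  obtain ⟨m0c, m1c, _⟩ := mem_ljTripleFI hQ0 ht0
  have hβ0 : FI.mem (betaLJ ‖p‖) B0 := betaLJ_of_mem_phiFI hQ0 hb0
  refine ⟨m0c, hβ0, ?_⟩
  have hpd : p + d = cb := by rw [hd]; abel
  simp only [hpd] at hSF
  have e1 : alphaLJ ‖p‖ * ‖p‖ * (⟪p, d⟫ / ‖p‖) = alphaLJ ‖p‖ * ⟪p, d⟫ := by field_simp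
  rw [e1] at hSF
  have hK0 : 0 ≤ K := by
    have hmT : FI.mem ‖p‖ T := mem_of_strict h0t.1 h0t.2
    have hq2 : FI.mem (‖p‖ ^ 2) (T.mul T) := by rw [sq]; exact FI.mem_mul hmT hmT
    obtain ⟨m0, m1, _⟩ := mem_ljTripleFI hq2 htt
    have h := kSlope_of_mem hρpos hmT.2 m0 m1
    exact le_trans (by positivity) h
  have hN : ‖d‖ ^ 2 ≤ (nd2S2 c w b : ℝ) / SC := by
    rw [le_div_iff₀ hS]; exact norm_sq_dVec2_le U hbox η hη b
  have hbound : K / 2 * ‖d‖ ^ 2 * ‖Δ‖ ≤ K / 2 * ((nd2S2 c w b : ℝ) / SC) * ‖Δ‖ :=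
    mul_le_mul_of_nonneg_right (mul_le_mul_of_nonneg_left hN (by linarith)) (norm_nonneg _)
  exact hSF.trans (by simpa [hKdef] using hbound)

/-! ## §2. The kernel arrays and the Boolean -/

/-- The label can be centred for the LJ slope leaf (positive tube, triple on the tube and at the centre, `β₀`). -/
def slopeLJLabelOK (c w : (Fin 3 × Fin 3) ⊕ Fin 3 → ℤ) (b : Fin 3 → ℤ) : Bool :=
  decide (0 < (tube2 c w b).lo) && (ttLJ c w b).isSome && (t0LJ c b).isSome && (phiFI (Q0 c b)).isSome

/-- Scaled slope remainder constant of the label (LJ). -/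
def KSlLJ (c w : (Fin 3 × Fin 3) ⊕ Fin 3 → ℤ) (b : Fin 3 → ℤ) : ℤ := kSlopeS ((ttLJ c w b).getD dflt3) (tube2 c w b)

/-- Kernel centre array `h⁰_b,ki` (LJ centre coefficients). -/
def H0LJ (c : (Fin 3 × Fin 3) ⊕ Fin 3 → ℤ) (b : Fin 3 → ℤ) (k i : Fin 3) : FI :=
  ((A0lj c b).mul ((cenVec c b k).mul (cenVec c b i))).add (if k = i then B0lj c b else FI.ofInt 0)

/-- ★ `H0LJ` encloses `H0r` at the LJ centre values. [folklore] -/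
theorem mem_H0LJ {c : (Fin 3 × Fin 3) ⊕ Fin 3 → ℤ} {b : Fin 3 → ℤ} {α β : ℝ} (hα : FI.mem α (A0lj c b)) (hβ : FI.mem β (B0lj c b))
    (k i : Fin 3) : FI.mem (H0r α β (cenPt c b) k i) (H0LJ c b k i) := by
  have hz : FI.mem (0 : ℝ) (FI.ofInt 0) := by simpa using FI.mem_ofInt 0
  unfold H0r H0LJ
  refine FI.mem_add (FI.mem_mul hα (FI.mem_mul (mem_cenVec c b k) (mem_cenVec c b i))) ?_
  split_ifs
  · exact hβ
  · exact hz

/-- First-order array `M_kl,i` (LJ). -/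
def MarrLJ (c : (Fin 3 × Fin 3) ⊕ Fin 3 → ℤ) (Lc : List (Fin 3 → ℤ)) (k l i : Fin 3) : FI := accFI Lc fun b => (H0LJ c b k i).mul (wVec c b l)
/-- First-order array `N_k,i` (LJ). -/
def NarrLJ (c : (Fin 3 × Fin 3) ⊕ Fin 3 → ℤ) (Lc : List (Fin 3 → ℤ)) (k i : Fin 3) : FI := accFI Lc fun b => H0LJ c b k i
/-- Scaled componentwise bound of the first-order term (LJ). -/
def VvecLJ (c w : (Fin 3 × Fin 3) ⊕ Fin 3 → ℤ) (Lc : List (Fin 3 → ℤ)) (i : Fin 3) : ℤ :=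
  cdiv (∑ k : Fin 3, ∑ l : Fin 3, w (Sum.inl (k, l)) * (MarrLJ c Lc k l i).absHi + ∑ k : Fin 3, uBound c w k * (NarrLJ c Lc k i).absHi) SC
/-- Scaled `ℓ²` bound of the first-order term (LJ). -/
def linLJ (c w : (Fin 3 × Fin 3) ⊕ Fin 3 → ℤ) (Lc : List (Fin 3 → ℤ)) : ℤ := (FI.sqrt ⟨0, cdiv (∑ i : Fin 3, VvecLJ c w Lc i ^ 2) SC⟩).hi
/-- Centre gradient (LJ). -/
def G0LJ (c : (Fin 3 × Fin 3) ⊕ Fin 3 → ℤ) (Lc : List (Fin 3 → ℤ)) (i : Fin 3) : FI := accFI Lc fun b => (B0lj c b).mul (cenVec c b i)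
/-- Scaled `ℓ²` bound of the centre gradient (LJ). -/
def g0LJ (c : (Fin 3 × Fin 3) ⊕ Fin 3 → ℤ) (Lc : List (Fin 3 → ℤ)) : ℤ := (FI.sqrt ⟨0, cdiv (∑ i : Fin 3, (G0LJ c Lc i).absHi ^ 2) SC⟩).hi
/-- Scaled second-order remainder (LJ). -/
def remSlLJ (c w : (Fin 3 × Fin 3) ⊕ Fin 3 → ℤ) (Lc : List (Fin 3 → ℤ)) : ℤ := (Lc.map fun b => cdiv (KSlLJ c w b * nd2S2 c w b) (2 * SC)).sum
/-- Naive gradient enclosure (LJ `β` over the box). -/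
def GnLJ (c w : (Fin 3 × Fin 3) ⊕ Fin 3 → ℤ) (Ln : List (Fin 3 → ℤ)) (i : Fin 3) : FI :=
  accFI Ln fun b => (((naiveLJ c w b).getD (FI.ofInt 0, FI.ofInt 0)).2).mul (vecB (boxE c w) (shufFI c w) b i)
/-- Scaled `ℓ²` bound of the naive part (LJ). -/
def naiSLJ (c w : (Fin 3 × Fin 3) ⊕ Fin 3 → ℤ) (Ln : List (Fin 3 → ℤ)) : ℤ := (FI.sqrt ⟨0, cdiv (∑ i : Fin 3, (GnLJ c w Ln i).absHi ^ 2) SC⟩).hi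

/-- ★ **THE CENTRED LJ SLOPE CHECK** over the box `(c, w)`, centred labels `Lc`, naive labels `Ln`, bound `Gs/SC`. -/
def slopeCheckLJ (c w : (Fin 3 × Fin 3) ⊕ Fin 3 → ℤ) (Lc Ln : List (Fin 3 → ℤ)) (Gs : ℤ) : Bool :=
  (Lc.all fun b => slopeLJLabelOK c w b) && (Ln.all fun b => (naiveLJ c w b).isSome) &&
    decide (g0LJ c Lc + linLJ c w Lc + remSlLJ c w Lc + naiSLJ c w Ln ≤ Gs)

/-- The computed LJ slope bound. -/
def slopeGsLJ (c w : (Fin 3 × Fin 3) ⊕ Fin 3 → ℤ) (Lc Ln : List (Fin 3 → ℤ)) : ℤ := g0LJ c Lc + linLJ c w Lc + remSlLJ c w Lc + naiSLJ c w Ln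

/-- `slopeCheckLJ` passes at the computed bound, given the guards. [formal bookkeeping] -/
theorem slopeCheckLJ_slopeGsLJ {c w : (Fin 3 × Fin 3) ⊕ Fin 3 → ℤ} {Lc Ln : List (Fin 3 → ℤ)}
    (hc : (Lc.all fun b => slopeLJLabelOK c w b) = true) (hn : (Ln.all fun b => (naiveLJ c w b).isSome) = true) :
    slopeCheckLJ c w Lc Ln (slopeGsLJ c w Lc Ln) = true := by
  unfold slopeCheckLJ slopeGsLJ
  simp only [Bool.and_eq_true, decide_eq_true_eq]
  exact ⟨⟨hc, hn⟩, le_rfl⟩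

/-! ## §3. ★★★ Soundness -/

/-- The per-label estimate from `slopeLJLabelOK`. [folklore chaining] -/
theorem label_slope_LJ_of_ok {c w : (Fin 3 × Fin 3) ⊕ Fin 3 → ℤ} {b : Fin 3 → ℤ} (h : slopeLJLabelOK c w b = true) (U : E3 →L[ℝ] E3)
    (hbox : ∀ ab : Fin 3 × Fin 3, |(U (EuclideanSpace.single ab.2 (1 : ℝ))) ab.1 - (c (Sum.inl ab) : ℝ) / SC| ≤ (w (Sum.inl ab) : ℝ) / SC)
    (η : E3) (hη : ∀ i : Fin 3, |η i - (c (Sum.inr i) : ℝ) / SC| ≤ (w (Sum.inr i) : ℝ) / SC) (Δ : E3) :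
    FI.mem (alphaLJ ‖cenPt c b‖) (A0lj c b) ∧ FI.mem (betaLJ ‖cenPt c b‖) (B0lj c b) ∧
      |betaLJ ‖latPt U hexFrame b + U (hcpShift + η)‖ * ⟪latPt U hexFrame b + U (hcpShift + η), Δ⟫ - betaLJ ‖cenPt c b‖ * ⟪cenPt c b, Δ⟫ -
          (alphaLJ ‖cenPt c b‖ * ⟪cenPt c b, latPt U hexFrame b + U (hcpShift + η) - cenPt c b⟫ * ⟪cenPt c b, Δ⟫ +
            betaLJ ‖cenPt c b‖ * ⟪latPt U hexFrame b + U (hcpShift + η) - cenPt c b, Δ⟫)| ≤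
        ((KSlLJ c w b : ℤ) : ℝ) / SC / 2 * ((nd2S2 c w b : ℝ) / SC) * ‖Δ‖ := by
  simp only [slopeLJLabelOK, Bool.and_eq_true, decide_eq_true_eq] at h
  obtain ⟨⟨⟨hlo, htt⟩, ht0⟩, hb0⟩ := h
  obtain ⟨tt, htt⟩ := Option.isSome_iff_exists.1 htt
  obtain ⟨t0, ht0⟩ := Option.isSome_iff_exists.1 ht0
  obtain ⟨B0, hb0⟩ := Option.isSome_iff_exists.1 hb0
  have eA : A0lj c b = t0.1 := by simp [A0lj, ht0]
  have eB : B0lj c b = B0 := by simp [B0lj, hb0]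
  have eK : KSlLJ c w b = kSlopeS tt (tube2 c w b) := by simp [KSlLJ, htt]
  rw [eA, eB, eK]
  exact label_slope_LJ hlo htt ht0 hb0 U hbox η hη Δ

/-- The remainder sum is below `remSlLJ/SC`. [arithmetic] -/
theorem remSlLJ_sum_le (c w : (Fin 3 × Fin 3) ⊕ Fin 3 → ℤ) {Lc : List (Fin 3 → ℤ)} (hLc : Lc.Nodup) :
    ∑ b ∈ Lc.toFinset, (KSlLJ c w b : ℝ) / SC / 2 * ((nd2S2 c w b : ℝ) / SC) ≤ (remSlLJ c w Lc : ℝ) / SC := by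
  classical
  have h1 : ∑ b ∈ Lc.toFinset, (KSlLJ c w b : ℝ) / SC / 2 * ((nd2S2 c w b : ℝ) / SC) ≤
      ∑ b ∈ Lc.toFinset, ((cdiv (KSlLJ c w b * nd2S2 c w b) (2 * SC) : ℤ) : ℝ) / SC := Finset.sum_le_sum fun b _ => rem_term_le _ _
  refine h1.trans (le_of_eq ?_)
  rw [← Finset.sum_div]
  congr 1
  rw [List.sum_toFinset _ hLc, remSlLJ, Int.cast_list_sum, List.map_map]
  rfl

/-- ★★★ **SOUNDNESS OF THE LJ SLOPE LEAF** (segment-slope form). [folklore chaining; skeleton of `…HomSlopeLeafC.slope_bound_of_slopeCheckC`] -/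
theorem slopeLJ_bound_of_check {c w : (Fin 3 × Fin 3) ⊕ Fin 3 → ℤ} {Lc Ln : List (Fin 3 → ℤ)} (hL : (Lc ++ Ln).Nodup) {Gs : ℤ}
    (h : slopeCheckLJ c w Lc Ln Gs = true) (U : E3 →L[ℝ] E3) (hU : ‖U - 1‖ ≤ 1 / 4)
    (hbox : ∀ ab : Fin 3 × Fin 3, |(U (EuclideanSpace.single ab.2 (1 : ℝ))) ab.1 - (c (Sum.inl ab) : ℝ) / SC| ≤ (w (Sum.inl ab) : ℝ) / SC)
    (ξ₀ : E3) (hξ₀ : ∀ i : Fin 3, |ξ₀ i - (c (Sum.inr i) : ℝ) / SC| ≤ (w (Sum.inr i) : ℝ) / SC) (hn₀ : ‖ξ₀‖ ≤ 1 / 4) (ξ : E3) :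
    |∑ b ∈ (Lc ++ Ln).toFinset, segG (fun x : ℝ => x⁻¹ ^ 7 - x⁻¹ ^ 13) (latPt U hexFrame b + U (hcpShift + ξ₀)) (U (ξ - ξ₀)) 0| ≤
      (Gs : ℝ) / SC * ‖U (ξ - ξ₀)‖ := by
  classical
  have hS : (0 : ℝ) < SC := by norm_num [SC]
  unfold slopeCheckLJ at h
  simp only [Bool.and_eq_true, List.all_eq_true, decide_eq_true_eq] at h
  obtain ⟨⟨hcen, hnai⟩, hsum⟩ := h
  obtain ⟨hLc, hLn, hdisj⟩ := List.nodup_append.1 hL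
  have hdisj' : List.Disjoint Lc Ln := fun a ha hb => hdisj a ha a hb rfl
  set Δ : E3 := U (ξ - ξ₀) with hΔ
  set cb : (Fin 3 → ℤ) → E3 := fun b => latPt U hexFrame b + U (hcpShift + ξ₀) with hcb
  have hρpos : ∀ b : Fin 3 → ℤ, 0 < ‖cb b‖ := fun b => lt_trans (by norm_num) (norm_shifted_gt hU hn₀ b)
  -- each summand is `betaLJ‖c_b‖·⟪c_b, Δ⟫`
  have hsummand : ∀ b ∈ (Lc ++ Ln).toFinset, segG (fun x : ℝ => x⁻¹ ^ 7 - x⁻¹ ^ 13) (cb b) Δ 0 = betaLJ ‖cb b‖ * ⟪cb b, Δ⟫ := by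
    intro b _; rw [segG_zero_eq, betaLJ_eq_profile (hρpos b).ne']
  rw [Finset.sum_congr rfl hsummand, List.toFinset_append, Finset.sum_union (List.disjoint_toFinset_iff_disjoint.2 hdisj')]
  -- NAIVE part
  have hCn : ∀ (b : Fin 3 → ℤ) (a : Fin 3), FI.mem (cb b a) (vecB (boxE c w) (shufFI c w) b a) :=
    fun b a => mem_vecB U ξ₀ (fun ab => mem_entryFI (hbox ab)) (fun i => mem_shufFI (hξ₀ i)) b a
  have hQn : ∀ b : Fin 3 → ℤ, FI.mem (‖cb b‖ ^ 2) (dot3 (vecB (boxE c w) (shufFI c w) b) (vecB (boxE c w) (shufFI c w) b)) := by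
    intro b; rw [← real_inner_self_eq_norm_sq]; exact mem_dot3 (hCn b) (hCn b)
  have hβn : ∀ b ∈ Ln, FI.mem (betaLJ ‖cb b‖) ((naiveLJ c w b).getD (FI.ofInt 0, FI.ofInt 0)).2 := by
    intro b hb
    obtain ⟨AB, hAB⟩ := Option.isSome_iff_exists.1 (hnai b hb)
    have := (mem_naiveLJ hAB (hQn b)).2
    rw [hAB]; simpa using this
  have hNai : |∑ b ∈ Ln.toFinset, betaLJ ‖cb b‖ * ⟪cb b, Δ⟫| ≤ (naiSLJ c w Ln : ℝ) / SC * ‖Δ‖ := by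
    have hre : ∑ b ∈ Ln.toFinset, betaLJ ‖cb b‖ * ⟪cb b, Δ⟫ = ∑ i, (∑ b ∈ Ln.toFinset, betaLJ ‖cb b‖ * cb b i) * Δ i := by
      calc ∑ b ∈ Ln.toFinset, betaLJ ‖cb b‖ * ⟪cb b, Δ⟫ = ∑ b ∈ Ln.toFinset, ∑ i, betaLJ ‖cb b‖ * cb b i * Δ i := by
            refine Finset.sum_congr rfl fun b _ => ?_
            rw [inner_eq_sum3, Finset.mul_sum]
            exact Finset.sum_congr rfl fun i _ => by ring
        _ = ∑ i, ∑ b ∈ Ln.toFinset, betaLJ ‖cb b‖ * cb b i * Δ i := Finset.sum_comm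
        _ = ∑ i, (∑ b ∈ Ln.toFinset, betaLJ ‖cb b‖ * cb b i) * Δ i := Finset.sum_congr rfl fun i _ => by rw [Finset.sum_mul]
    rw [hre]
    refine abs_sum_mul_le_sqrtHi _ Δ (fun i => (GnLJ c w Ln i).absHi) fun i => ?_
    exact FI.abs_le_absHi (mem_accFI Ln hLn fun b hb => FI.mem_mul (hβn b hb) (hCn b i))
  -- CENTRED part
  have hlf := fun b (hb : b ∈ Lc) => label_slope_LJ_of_ok (hcen b hb) U hbox ξ₀ hξ₀ Δ
  set pc : (Fin 3 → ℤ) → E3 := fun b => cenPt c b with hpc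
  have hG0 : |∑ b ∈ Lc.toFinset, betaLJ ‖pc b‖ * ⟪pc b, Δ⟫| ≤ (g0LJ c Lc : ℝ) / SC * ‖Δ‖ := by
    have hre : ∑ b ∈ Lc.toFinset, betaLJ ‖pc b‖ * ⟪pc b, Δ⟫ = ∑ i, (∑ b ∈ Lc.toFinset, betaLJ ‖pc b‖ * pc b i) * Δ i := by
      calc ∑ b ∈ Lc.toFinset, betaLJ ‖pc b‖ * ⟪pc b, Δ⟫ = ∑ b ∈ Lc.toFinset, ∑ i, betaLJ ‖pc b‖ * pc b i * Δ i := by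
            refine Finset.sum_congr rfl fun b _ => ?_
            rw [inner_eq_sum3, Finset.mul_sum]
            exact Finset.sum_congr rfl fun i _ => by ring
        _ = ∑ i, ∑ b ∈ Lc.toFinset, betaLJ ‖pc b‖ * pc b i * Δ i := Finset.sum_comm
        _ = ∑ i, (∑ b ∈ Lc.toFinset, betaLJ ‖pc b‖ * pc b i) * Δ i := Finset.sum_congr rfl fun i _ => by rw [Finset.sum_mul]
    rw [hre]
    refine abs_sum_mul_le_sqrtHi _ Δ (fun i => (G0LJ c Lc i).absHi) fun i => ?_
    exact FI.abs_le_absHi (mem_accFI Lc hLc fun b hb => FI.mem_mul (hlf b hb).2.1 (mem_cenVec c b i))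
  set X : Fin 3 → ℝ := fun i => ∑ b ∈ Lc.toFinset, ∑ k, (cb b - pc b) k * H0r (alphaLJ ‖pc b‖) (betaLJ ‖pc b‖) (pc b) k i with hX
  have hlin_eq : ∑ b ∈ Lc.toFinset, (alphaLJ ‖pc b‖ * ⟪pc b, cb b - pc b⟫ * ⟪pc b, Δ⟫ + betaLJ ‖pc b‖ * ⟪cb b - pc b, Δ⟫) = ∑ i, X i * Δ i := by
    rw [Finset.sum_congr rfl fun b _ => linSlope_eq (pc b) (cb b - pc b) Δ (alphaLJ ‖pc b‖) (betaLJ ‖pc b‖), Finset.sum_comm]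
    refine Finset.sum_congr rfl fun i _ => ?_
    rw [hX, Finset.sum_mul]
  have hXb : ∀ i, |X i| * SC ≤ (VvecLJ c w Lc i : ℝ) := by
    intro i
    have hd : ∀ (b : Fin 3 → ℤ) (k : Fin 3), (cb b - pc b) k =
        ∑ l : Fin 3, ((U (EuclideanSpace.single l (1 : ℝ))) k - (c (Sum.inl (k, l)) : ℝ) / SC) * wPt c b l + (U (ξ₀ - cenShuf c)) k :=
      fun b k => dVec_formula c U ξ₀ b k
    have hre : X i = ∑ k, ∑ l, ((U (EuclideanSpace.single l (1 : ℝ))) k - (c (Sum.inl (k, l)) : ℝ) / SC) *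
        (∑ b ∈ Lc.toFinset, wPt c b l * H0r (alphaLJ ‖pc b‖) (betaLJ ‖pc b‖) (pc b) k i) +
        ∑ k, (U (ξ₀ - cenShuf c)) k * ∑ b ∈ Lc.toFinset, H0r (alphaLJ ‖pc b‖) (betaLJ ‖pc b‖) (pc b) k i := by
      rw [hX]
      simp only []
      rw [Finset.sum_congr rfl fun b _ => Finset.sum_congr rfl fun k _ => by rw [hd b k]]
      exact pert_rearrange Lc.toFinset (fun k l => (U (EuclideanSpace.single l (1 : ℝ))) k - (c (Sum.inl (k, l)) : ℝ) / SC)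
        (fun k => (U (ξ₀ - cenShuf c)) k) (fun b l => wPt c b l) (fun b k => H0r (alphaLJ ‖pc b‖) (betaLJ ‖pc b‖) (pc b) k i)
    have hM : ∀ k l, FI.mem (∑ b ∈ Lc.toFinset, wPt c b l * H0r (alphaLJ ‖pc b‖) (betaLJ ‖pc b‖) (pc b) k i) (MarrLJ c Lc k l i) := by
      intro k l
      refine mem_accFI Lc hLc fun b hb => ?_
      rw [mul_comm]
      exact FI.mem_mul (mem_H0LJ (hlf b hb).1 (hlf b hb).2.1 k i) (mem_wVec c b l)
    have hN : ∀ k, FI.mem (∑ b ∈ Lc.toFinset, H0r (alphaLJ ‖pc b‖) (betaLJ ‖pc b‖) (pc b) k i) (NarrLJ c Lc k i) := by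
      intro k
      exact mem_accFI Lc hLc fun b hb => mem_H0LJ (hlf b hb).1 (hlf b hb).2.1 k i
    have habs := pert_abs_le (fun k l => (U (EuclideanSpace.single l (1 : ℝ))) k - (c (Sum.inl (k, l)) : ℝ) / SC)
      (fun k l => ∑ b ∈ Lc.toFinset, wPt c b l * H0r (alphaLJ ‖pc b‖) (betaLJ ‖pc b‖) (pc b) k i) (fun k l => (w (Sum.inl (k, l)) : ℝ) / SC)
      (fun k l => ((MarrLJ c Lc k l i).absHi : ℝ) / SC) (fun k => (U (ξ₀ - cenShuf c)) k)
      (fun k => ∑ b ∈ Lc.toFinset, H0r (alphaLJ ‖pc b‖) (betaLJ ‖pc b‖) (pc b) k i)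
      (fun k => (uBound c w k : ℝ) / SC) (fun k => ((NarrLJ c Lc k i).absHi : ℝ) / SC)
      (fun k l => hbox (k, l)) (fun k l => by rw [le_div_iff₀ hS]; exact FI.abs_le_absHi (hM k l))
      (fun k => by rw [le_div_iff₀ hS]; exact abs_shift_le U hbox ξ₀ hξ₀ k) (fun k => by rw [le_div_iff₀ hS]; exact FI.abs_le_absHi (hN k))
    rw [← hre] at habs
    have hsum' : (∑ k : Fin 3, ∑ l : Fin 3, (w (Sum.inl (k, l)) : ℝ) / SC * (((MarrLJ c Lc k l i).absHi : ℝ) / SC) +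
        ∑ k : Fin 3, (uBound c w k : ℝ) / SC * (((NarrLJ c Lc k i).absHi : ℝ) / SC)) * SC =
        ((∑ k : Fin 3, ∑ l : Fin 3, w (Sum.inl (k, l)) * (MarrLJ c Lc k l i).absHi + ∑ k : Fin 3, uBound c w k * (NarrLJ c Lc k i).absHi : ℤ) : ℝ) / SC := by
      push_cast
      rw [eq_div_iff hS.ne']
      simp only [add_mul, Finset.sum_mul]
      congr 1
      · refine Finset.sum_congr rfl fun k _ => Finset.sum_congr rfl fun l _ => ?_
        field_simp
      · refine Finset.sum_congr rfl fun k _ => ?_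
        field_simp
    have hcd := div_le_cdiv (a := ∑ k : Fin 3, ∑ l : Fin 3, w (Sum.inl (k, l)) * (MarrLJ c Lc k l i).absHi +
      ∑ k : Fin 3, uBound c w k * (NarrLJ c Lc k i).absHi) (b := (SC : ℤ)) (by exact_mod_cast hS)
    calc |X i| * SC ≤ _ := mul_le_mul_of_nonneg_right habs hS.le
      _ = _ := hsum'
      _ ≤ (VvecLJ c w Lc i : ℝ) := by rw [VvecLJ]; exact_mod_cast hcd
  have hLin : |∑ i, X i * Δ i| ≤ (linLJ c w Lc : ℝ) / SC * ‖Δ‖ := abs_sum_mul_le_sqrtHi X Δ (fun i => VvecLJ c w Lc i) hXb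
  have hRem : |∑ b ∈ Lc.toFinset, (betaLJ ‖cb b‖ * ⟪cb b, Δ⟫ - betaLJ ‖pc b‖ * ⟪pc b, Δ⟫ -
      (alphaLJ ‖pc b‖ * ⟪pc b, cb b - pc b⟫ * ⟪pc b, Δ⟫ + betaLJ ‖pc b‖ * ⟪cb b - pc b, Δ⟫))| ≤ (remSlLJ c w Lc : ℝ) / SC * ‖Δ‖ := by
    refine (Finset.abs_sum_le_sum_abs _ _).trans ?_
    have h1 : ∑ b ∈ Lc.toFinset, |betaLJ ‖cb b‖ * ⟪cb b, Δ⟫ - betaLJ ‖pc b‖ * ⟪pc b, Δ⟫ -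
        (alphaLJ ‖pc b‖ * ⟪pc b, cb b - pc b⟫ * ⟪pc b, Δ⟫ + betaLJ ‖pc b‖ * ⟪cb b - pc b, Δ⟫)| ≤
        ∑ b ∈ Lc.toFinset, (KSlLJ c w b : ℝ) / SC / 2 * ((nd2S2 c w b : ℝ) / SC) * ‖Δ‖ :=
      Finset.sum_le_sum fun b hb => (hlf b (List.mem_toFinset.1 hb)).2.2
    refine h1.trans ?_
    rw [← Finset.sum_mul]
    exact mul_le_mul_of_nonneg_right (remSlLJ_sum_le c w hLc) (norm_nonneg _)
  have hCen : |∑ b ∈ Lc.toFinset, betaLJ ‖cb b‖ * ⟪cb b, Δ⟫| ≤ ((g0LJ c Lc : ℝ) / SC + (linLJ c w Lc : ℝ) / SC + (remSlLJ c w Lc : ℝ) / SC) * ‖Δ‖ := by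
    have hsplit : ∑ b ∈ Lc.toFinset, betaLJ ‖cb b‖ * ⟪cb b, Δ⟫ =
        ∑ b ∈ Lc.toFinset, betaLJ ‖pc b‖ * ⟪pc b, Δ⟫ +
        ∑ b ∈ Lc.toFinset, (alphaLJ ‖pc b‖ * ⟪pc b, cb b - pc b⟫ * ⟪pc b, Δ⟫ + betaLJ ‖pc b‖ * ⟪cb b - pc b, Δ⟫) +
        ∑ b ∈ Lc.toFinset, (betaLJ ‖cb b‖ * ⟪cb b, Δ⟫ - betaLJ ‖pc b‖ * ⟪pc b, Δ⟫ -
          (alphaLJ ‖pc b‖ * ⟪pc b, cb b - pc b⟫ * ⟪pc b, Δ⟫ + betaLJ ‖pc b‖ * ⟪cb b - pc b, Δ⟫)) := by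
      rw [← Finset.sum_add_distrib, ← Finset.sum_add_distrib]
      exact Finset.sum_congr rfl fun b _ => by ring
    rw [hsplit, hlin_eq]
    calc |∑ b ∈ Lc.toFinset, betaLJ ‖pc b‖ * ⟪pc b, Δ⟫ + ∑ i, X i * Δ i +
          ∑ b ∈ Lc.toFinset, (betaLJ ‖cb b‖ * ⟪cb b, Δ⟫ - betaLJ ‖pc b‖ * ⟪pc b, Δ⟫ -
            (alphaLJ ‖pc b‖ * ⟪pc b, cb b - pc b⟫ * ⟪pc b, Δ⟫ + betaLJ ‖pc b‖ * ⟪cb b - pc b, Δ⟫))|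
        ≤ |∑ b ∈ Lc.toFinset, betaLJ ‖pc b‖ * ⟪pc b, Δ⟫| + |∑ i, X i * Δ i| +
          |∑ b ∈ Lc.toFinset, (betaLJ ‖cb b‖ * ⟪cb b, Δ⟫ - betaLJ ‖pc b‖ * ⟪pc b, Δ⟫ -
            (alphaLJ ‖pc b‖ * ⟪pc b, cb b - pc b⟫ * ⟪pc b, Δ⟫ + betaLJ ‖pc b‖ * ⟪cb b - pc b, Δ⟫))| := abs_add_three _ _ _
      _ ≤ (g0LJ c Lc : ℝ) / SC * ‖Δ‖ + (linLJ c w Lc : ℝ) / SC * ‖Δ‖ + (remSlLJ c w Lc : ℝ) / SC * ‖Δ‖ := by linarith [hG0, hLin, hRem]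
      _ = _ := by ring
  have hGs : (g0LJ c Lc : ℝ) / SC + (linLJ c w Lc : ℝ) / SC + (remSlLJ c w Lc : ℝ) / SC + (naiSLJ c w Ln : ℝ) / SC ≤ (Gs : ℝ) / SC := by
    rw [← add_div, ← add_div, ← add_div]
    refine div_le_div_of_nonneg_right ?_ hS.le
    exact_mod_cast hsum
  have hΔ0 : 0 ≤ ‖Δ‖ := norm_nonneg _
  calc |∑ b ∈ Lc.toFinset, betaLJ ‖cb b‖ * ⟪cb b, Δ⟫ + ∑ b ∈ Ln.toFinset, betaLJ ‖cb b‖ * ⟪cb b, Δ⟫|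
      ≤ |∑ b ∈ Lc.toFinset, betaLJ ‖cb b‖ * ⟪cb b, Δ⟫| + |∑ b ∈ Ln.toFinset, betaLJ ‖cb b‖ * ⟪cb b, Δ⟫| := abs_add_le _ _
    _ ≤ ((g0LJ c Lc : ℝ) / SC + (linLJ c w Lc : ℝ) / SC + (remSlLJ c w Lc : ℝ) / SC) * ‖Δ‖ + (naiSLJ c w Ln : ℝ) / SC * ‖Δ‖ := add_le_add hCen hNai
    _ = ((g0LJ c Lc : ℝ) / SC + (linLJ c w Lc : ℝ) / SC + (remSlLJ c w Lc : ℝ) / SC + (naiSLJ c w Ln : ℝ) / SC) * ‖Δ‖ := by ring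
    _ ≤ (Gs : ℝ) / SC * ‖Δ‖ := mul_le_mul_of_nonneg_right hGs hΔ0

/-- ★★★ **THE REFERENCE FORCE BOUND `f₀` OF THE RING LEMMA IN KERNEL FORM**: `|Σ_b (‖X_b‖⁻⁸ − ‖X_b‖⁻¹⁴)⟪X_b, U(ξ−ξ₀)⟫| ≤ (Gs/SC)‖U(ξ−ξ₀)‖` with
`X_b = latPt U hexFrame b + U(hcpShift + ξ₀)` — the `hf₀` input of `…HomCurvLJRing.hcpForceLJ_slab_of_checkLJ`. [folklore chaining: `segG_ljProfile_zero`] -/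
theorem forceLJ_ref_bound_of_check {c w : (Fin 3 × Fin 3) ⊕ Fin 3 → ℤ} {Lc Ln : List (Fin 3 → ℤ)} (hL : (Lc ++ Ln).Nodup) {Gs : ℤ}
    (h : slopeCheckLJ c w Lc Ln Gs = true) (U : E3 →L[ℝ] E3) (hU : ‖U - 1‖ ≤ 1 / 4)
    (hbox : ∀ ab : Fin 3 × Fin 3, |(U (EuclideanSpace.single ab.2 (1 : ℝ))) ab.1 - (c (Sum.inl ab) : ℝ) / SC| ≤ (w (Sum.inl ab) : ℝ) / SC)
    (ξ₀ : E3) (hξ₀ : ∀ i : Fin 3, |ξ₀ i - (c (Sum.inr i) : ℝ) / SC| ≤ (w (Sum.inr i) : ℝ) / SC) (hn₀ : ‖ξ₀‖ ≤ 1 / 4) (ξ : E3) :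
    |∑ bb ∈ (Lc ++ Ln).toFinset, (‖latPt U hexFrame bb + U (hcpShift + ξ₀)‖⁻¹ ^ 8 - ‖latPt U hexFrame bb + U (hcpShift + ξ₀)‖⁻¹ ^ 14) *
        ⟪latPt U hexFrame bb + U (hcpShift + ξ₀), U (ξ - ξ₀)⟫| ≤ (Gs : ℝ) / SC * ‖U (ξ - ξ₀)‖ := by
  have key := slopeLJ_bound_of_check hL h U hU hbox ξ₀ hξ₀ hn₀ ξ
  rw [Finset.sum_congr rfl fun bb _ => segG_ljProfile_zero (latPt U hexFrame bb + U (hcpShift + ξ₀)) (U (ξ - ξ₀))] at key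
  exact key

end Summit.AtomisticToContinuum.Crystallization.Theorems.FrustratedLawDichotomyStrainedPatchHomSlopeLJ

end
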